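import Literature.NumberTheory.Rogawski1990.RankOneUnstableDeltaValueInert                       -- ★ p08 (g14) I-4b: `exists_forall_localComponent_eq_one_of_valued_sub_one_le` (no `hunr`), the inert twin
import Literature.NumberTheory.Automorphic.Liu2021.LemD1AsPrintedIndexedNonVacuityRamifiedPlace     -- ★ `inertiaDeg_eq_one_of_ne_one` (`f(w|v) = 1` at a ramified non-split place)
import HarnessLib

/-!
# [Rogawski1990 Lemma 4.9.3; LabesseLanglands1979 §2] road «R1-ram», brick R-4: the VALUE of the rank-one transfer factor `Δ_{H∕C}(t) = μ_w(γ₁ − γ₃)⁻¹·|γ₁ − γ₃|_w^{1∕2}`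
# at a RAMIFIED non-split place under the μ-guard — `μ_w(z − 1) = μ_w(2η)·(b₀, θ)_v` with `b₀` the Cayley parameter of `z = γ₁∕γ₃`

Topic `NumberTheory/Rogawski1990`; namespace `Literature.NumberTheory.Rogawski1990`.  THEOREMS ONLY (no definition, no instance, no notation, no named fact, no `sorry`).
Cell `pub/hodgecm-mathlib` (D-0151), crux H413 = `stmt-HodgeConjecture-24833`, line «N6nsGerm», stub `stub_N6nsR1LL` (#159; letter ★ `RankOneUnstableTransferNonsplitCME`, ramified
residue ★ `RankOneUnstableTransferNonsplitCMERamified`); LEAD F0P3a-plan (g10); architect A-p16 (g27) RULING A-14 (c) «R-4 → B-p10 (g26)»; road of record F0P3-p02 (g12)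
MEMO-R1ram §3 (S4) ∕ §4 R-4.  This is the RAMIFIED twin of ★ p08 (g14) `RankOneUnstableDeltaValueInert` (I-4b).  HONEST LABEL: HC_CM is proved only modulo the printed citations
(the 2 remaining named inputs hLiu418, h413) until rung 0 closes; nothing printed is asserted here.

THE MATHEMATICS.  `L` CM, `v` a finite place of `L⁺` NON-SPLIT in `L` (`c • w = w`), `K = L_w`, `σ = σ_w`, `ι_w : L⁺_v → L_w`, `ϖ = ι_w(ϖ_v)`, `μ` a Hecke character of `L` with
print's guard `μ|_{𝕀_{L⁺}} = ω_{L∕L⁺}` (the hypothesis line of ★ `RankOneUnstableTransferNonsplitCME`), `θ` the CM generator (`L = L⁺(√θ)`, `α² = θ`, `cα = −α`).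
At an UNRAMIFIED inert place p08 proved `μ_w(z − 1) = (−1)^N μ_w(δ)` for `z ∈ K¹`, `ord_w(z − 1) = N ≥ M₀`: the sign depends on the DEPTH only, because `ω_v` is trivial on
`𝒪_vˣ`.  At a RAMIFIED place `ω_v` is NON-trivial on `𝒪_vˣ` and `μ_w(z − 1)` depends on the ANGLE of `z` as well — through exactly ONE Hilbert symbol, read off the
CAYLEY PARAMETER: for `z ∈ K¹ = {σz·z = 1}`, `z ≠ −1`, the element `s := (z − 1)∕(z + 1)` is SKEW (`σs = −s`, §1), so for any fixed skew `η ≠ 0` (e.g. `η = (α)_w`) the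
quotient `s∕η` is `σ`-FIXED, i.e. `s∕η = ι_w(b₀)` with `b₀ ∈ L⁺_v` (★ `exists_toPlace_eq_of_galAdicCompletionMap_eq`), and
  `z − 1 = (2η) · ι_w(b₀) · (z + 1)∕2`,   so   **`μ_w(z − 1) = μ_w(2η) · (b₀, θ)_v · μ_w((z + 1)∕2) = μ_w(2η) · (b₀, θ)_v`**
as soon as `|z − 1|_w ≤ |2ϖ^{M₀}|_w` (`μ_w` is trivial on `1 + ϖ^{M₀}𝒪_w`, ★ p08 `exists_forall_localComponent_eq_one_of_valued_sub_one_le`, no ramification hypothesis; and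
`μ_w(ι_w β) = (β, θ)_v` for EVERY `β ∈ L⁺_vˣ` by the guard, ★ `quadraticHeckeChar_localUnits`).  MEMO-R1ram (S4) writes the same value as `μ_w(γ₃)·μ_w(2η)·μ_w(σz_{H90})⁻¹·ω(b)`
for a Hilbert-90 numerator `z_{H90} = a + bη`; the Cayley parameter `b₀ = b∕a` absorbs the non-canonical `a`.  §1–§2 hold at EVERY non-split place (wild included); the ramified
hypothesis `he : e(w|v) ≠ 1` (A-p06∕Liu2021 currency) enters only §3's `D_H`: `‖·‖_w = q^{−ord_w}` with `q = #k_v = #k_w` (`f(w|v) = 1`, ★ `inertiaDeg_eq_one_of_ne_one`), so for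
`ord_w(γ₁ − γ₃) = 2r + 1` (odd near the singular torus at a ramified place) `D_H = q^{−r}·q^{−1∕2}`.

* §1 `exists_skew_ne_zero` (`η = (α)_w`), `galAdicCompletionMap_cayley_eq_neg` (`σ((z−1)∕(z+1)) = −(z−1)∕(z+1)` on `K¹`), `galAdicCompletionMap_div_eq_self_of_skew`,
  `exists_units_toPlace_eq_cayley_div` (the Cayley parameter `b₀ ∈ L⁺_vˣ`), `sub_one_eq_mul_toPlace_mul` (`z − 1 = (2η)·ι_w b₀·(z+1)∕2`).
* §2 (guard) **`localComponent_map_toPlace_eq_hilbertSymbol`** (`μ_w(ι_w β) = (β, θ)_v`), CORE **`localComponent_sub_one_eq_mul_hilbertSymbol`**.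
* §3 (letter tokens `E_v = LocalRing L v`, `conjLocal`, ★ `finHeckeValue`) `absNorm_placesOver_eq_of_ramified` (`N𝔓_w = N𝔭_v`), `sqrt_prod_norm_eq_sqrt_zpow_log_of_ramified`,
  `sqrt_prod_norm_eq_of_log_eq_neg_odd` (`D_H = q^{−r}·(√q)⁻¹`), HEAD **`exists_finHeckeValue_sub_inv_eq_mul_hilbertSymbol`**
  (`μ_v(a − c)⁻¹ = μ_v(c)⁻¹ · C⁻¹ · (b₀, θ)_v`, `C = μ_w(2η)`, for norm-one `a, c ∈ E_v` deep enough, `b₀` the Cayley parameter of `a_w∕c_w`).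
Interface with R-3∕R-5 (MEMO (S3)(S5)): the window classes' κ-weight should be typed as `(b₀(t), θ)_v` with the SAME `b₀(t) := (γ₁∕γ₃ − 1)∕((γ₁∕γ₃ + 1)·η)`; then «the two signs
square away» is `(b₀,θ)_v² = 1` (`hilbertSymbol_sq_cast` below).  No Legendre evaluation of `(β, θ)_v` is made here (tame dictionary: ★ `finKappaAt_eq_hilbertSymbol_of_nonsplit`,
★ `RamifiedQuadraticNorm.exists_mul_map_eq_iff_quadraticChar_eq_one` on demand).

## References
* [Rogawski1990] J. D. Rogawski, *Automorphic Representations of Unitary Groups in Three Variables*, Ann. of Math. Stud. 123 (1990): §4.9 Lemma 4.9.3, (4.9.2) p. 56; §4.9 p. 55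
  (`μ|_{F^×} = ω_{E∕F}`, `D_H`); §4.3 (4.3.1) p. 43.
* [LabesseLanglands1979] J.-P. Labesse, R. P. Langlands, *L-indistinguishability for SL(2)*, Canad. J. Math. 31 (1979): §2, Lemma 2.1, (2.1)–(2.2) pp. 8–9 (the ramified
  torus: `δ_m = 2q^m`, the weight `κ(bϖ^{−m})`).
* [Serre1979] J.-P. Serre, *Local Fields*, GTM 67 (1979): Ch. V §3 (ramified quadratic norms), Ch. XIV §3 (the local symbol `(·, θ)_v`).
* [NeukirchANT1999] J. Neukirch, *Algebraic Number Theory* (1999): Ch. I §8 Prop. 8.2 (`efg = n`), Ch. II §6 (`‖·‖_w = (#k_w)^{−ord_w}`).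
* [TateThesis1967] J. Tate, *Fourier analysis in number fields and Hecke's zeta-functions*: §2.3 (quasi-characters are trivial on some `1 + 𝔭^n`).
-/

set_option autoImplicit false

noncomputable section

open NumberField IsDedekindDomain Filter Topology ValuativeRel
open scoped ValuativeRel

namespace Literature.NumberTheory.Rogawski1990

open Literature.NumberTheory.Automorphic Literature.NumberTheory.Automorphic.UnitaryGroup Literature.NumberTheory.GaloisRepresentations
open Literature.NumberTheory.QuadraticForms Literature.NumberTheory.NumberFields
open Literature.NumberTheory.GelbartRogawski1991.UnitaryDualPair.LocalSplitting (ideleBaseChange_localUnits_of_smul_eq)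

variable (L : Type) [Field L] [NumberField L] [IsCMField L] (v : HeightOneSpectrum (𝓞 ↥(maximalRealSubfield L)))
  (w : PlacesOver L v) (hw : IsCMField.complexConj L • w.1 = w.1)

/-! ## §1 One-place algebra at a non-split place: a skew element, the Cayley parameter of a norm-one element -/

section OnePlace

include hw in
/-- **A NON-ZERO SKEW ELEMENT of `L_w`**: `η := (α)_w` with `α` the CM generator (`cα = −α`, `α ≠ 0`) has `σ_w η = −η`, `η ≠ 0`.
[cite: Rogawski1990, §4.9 p. 55 (`E = F(√θ)`)] -/
theorem exists_skew_ne_zero :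
    ∃ η : w.1.adicCompletion L, galAdicCompletionMap (L := L) (IsCMField.complexConj L) hw η = -η ∧ η ≠ 0 := by
  obtain ⟨α, hα0, hcα, -⟩ := cmQuadraticGenerator_spec L
  refine ⟨algebraMap L (w.1.adicCompletion L) α, ?_, ?_⟩
  · rw [galAdicCompletionMap_complexConj_algebraMap L v w hw α, cmConjRingHom_apply, hcα, map_neg]
  · exact fun h0 => hα0 ((algebraMap L (w.1.adicCompletion L)).injective (by rw [h0, map_zero]))

/-- **THE CAYLEY TRANSFORM OF A NORM-ONE ELEMENT IS SKEW**: if `σz·z = 1` and `z + 1 ≠ 0` then `σ((z − 1)∕(z + 1)) = −(z − 1)∕(z + 1)` (`σz = z⁻¹`).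
[cite: LabesseLanglands1979, §2 (the torus `T = L^×`, `γ ↦ γ∕γ̄`)] [cite: Serre1979, Ch. X §1 (Hilbert 90)] -/
theorem galAdicCompletionMap_cayley_eq_neg {z : w.1.adicCompletion L}
    (hz : galAdicCompletionMap (L := L) (IsCMField.complexConj L) hw z * z = 1) (hz1 : z + 1 ≠ 0) :
    galAdicCompletionMap (L := L) (IsCMField.complexConj L) hw ((z - 1) / (z + 1)) = -((z - 1) / (z + 1)) := by
  set σ := galAdicCompletionMap (L := L) (IsCMField.complexConj L) hw with hσdef
  have hz0 : z ≠ 0 := fun h0 => by rw [h0, mul_zero] at hz; exact zero_ne_one hz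
  have hσz : σ z = z⁻¹ := eq_inv_of_mul_eq_one_left hz
  have hz1' : z⁻¹ + 1 ≠ 0 := by
    intro h
    apply hz1
    have : z⁻¹ = -1 := eq_neg_of_add_eq_zero_left h
    have hz' : z = -1 := by rw [← inv_inv z, this, inv_neg, inv_one]
    rw [hz', neg_add_cancel]
  have e1 : z⁻¹ - 1 = (1 - z) / z := by field_simp
  have e2 : z⁻¹ + 1 = (1 + z) / z := by field_simp
  rw [map_div₀, map_sub, map_add, map_one, hσz, e1, e2, div_div_div_cancel_right₀ hz0]
  ring

/-- **SKEW ∕ SKEW IS FIXED**: `σs = −s`, `ση = −η` ⇒ `σ(s∕η) = s∕η`. [cite: Rogawski1990, §4.9 p. 55] -/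
theorem galAdicCompletionMap_div_eq_self_of_skew {s η : w.1.adicCompletion L}
    (hs : galAdicCompletionMap (L := L) (IsCMField.complexConj L) hw s = -s) (hη : galAdicCompletionMap (L := L) (IsCMField.complexConj L) hw η = -η) :
    galAdicCompletionMap (L := L) (IsCMField.complexConj L) hw (s / η) = s / η := by
  rw [map_div₀, hs, hη, neg_div_neg_eq]

include hw in
/-- **THE CAYLEY PARAMETER `b₀ ∈ L⁺_vˣ`** of a norm-one `z ≠ ±1`: `ι_w(b₀) = (z − 1)∕((z + 1)·η)` for the fixed skew `η ≠ 0` (the quotient is `σ_w`-fixed, hence comes from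
`L⁺_v`, ★ `exists_toPlace_eq_of_galAdicCompletionMap_eq`; it is non-zero since `z ≠ 1`). [cite: LabesseLanglands1979, §2 (2.1) (the parameter `b` of `γ = a + bτ`)] -/
theorem exists_units_toPlace_eq_cayley_div {η : w.1.adicCompletion L} (hη : galAdicCompletionMap (L := L) (IsCMField.complexConj L) hw η = -η) (hη0 : η ≠ 0)
    {z : w.1.adicCompletion L} (hz : galAdicCompletionMap (L := L) (IsCMField.complexConj L) hw z * z = 1) (hz1 : z + 1 ≠ 0) (hz1' : z - 1 ≠ 0) :
    ∃ b₀ : (v.adicCompletion ↥(maximalRealSubfield L))ˣ,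
      toPlace v w (b₀ : v.adicCompletion ↥(maximalRealSubfield L)) = (z - 1) / ((z + 1) * η) := by
  have hfix := galAdicCompletionMap_div_eq_self_of_skew L v w hw (galAdicCompletionMap_cayley_eq_neg L v w hw hz hz1) hη
  obtain ⟨p, hp⟩ := exists_toPlace_eq_of_galAdicCompletionMap_eq (IsCMField.complexConj L) w (IsCMField.complexConj_ne_one L) hw _ hfix
  have hp0 : p ≠ 0 := by
    intro h0
    rw [h0, map_zero] at hp
    exact div_ne_zero (div_ne_zero hz1' hz1) hη0 hp.symm
  exact ⟨Units.mk0 p hp0, by rw [Units.val_mk0, hp, div_div]⟩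

omit [IsCMField L] in
/-- **`z − 1 = (2η) · ι_w b₀ · (z + 1)∕2`** for the Cayley parameter `b₀` (`2 ≠ 0`, `η ≠ 0`, `z + 1 ≠ 0`). [cite: LabesseLanglands1979, §2 (2.1)] -/
theorem sub_one_eq_mul_toPlace_mul {η z y : w.1.adicCompletion L} (hη0 : η ≠ 0) (hz1 : z + 1 ≠ 0) (h2 : (2 : w.1.adicCompletion L) ≠ 0)
    (hb : y = (z - 1) / ((z + 1) * η)) : z - 1 = (2 * η) * y * ((z + 1) / 2) := by
  rw [hb]
  field_simp

end OnePlace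

/-! ## §2 `μ_w` under the guard `μ|_{𝕀_{L⁺}} = ω_{L∕L⁺}`: `μ_w(ι_w β) = (β, θ)_v`, and the CORE -/

section Guard

variable (μ : HeckeCharacter L)
  (hμω : ∀ x : ideleGroup ↥(maximalRealSubfield L), μ (AdeleRing.ideleBaseChange ↥(maximalRealSubfield L) L x) = quadraticHeckeCharCM L x)

/-- `((b₀, θ)_v : ℂ)² = 1` — the Hilbert symbol is `±1`. [cite: Serre1979, Ch. XIV §3] -/
private theorem hilbertSymbol_cast_mul_self {F : Type*} [Field F] (a b : F) : ((hilbertSymbol F a b : ℤ) : ℂ) * ((hilbertSymbol F a b : ℤ) : ℂ) = 1 := by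
  unfold hilbertSymbol
  split_ifs <;> norm_num

include hw hμω in
/-- **`μ_w(ι_w β) = (β, θ)_v` FOR EVERY `β ∈ L⁺_vˣ`** under the guard (`μ_w(ι_w β) = μ(⟨β⟩_v ⊗ 1) = ω(⟨β⟩_v) = (β, θ)_v`, ★ `ideleBaseChange_localUnits_of_smul_eq` + ★
`quadraticHeckeChar_localUnits`); NO ramification hypothesis — this is p08's `localComponent_map_toPlace_eq_one_of_valued_eq_one` with the unramified evaluation `(β,θ)_v = 1` removed.
[cite: Rogawski1990, §4.9 p. 55 (`μ|_{F^×} = ω_{E∕F}`)] [cite: Serre1979, Ch. XIV §3] -/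
theorem localComponent_map_toPlace_eq_hilbertSymbol (β : (v.adicCompletion ↥(maximalRealSubfield L))ˣ) :
    ((μ.localComponent w.1 (Units.map (toPlace v w : v.adicCompletion ↥(maximalRealSubfield L) →* w.1.adicCompletion L) β) : ℂˣ) : ℂ) =
      (hilbertSymbol (v.adicCompletion ↥(maximalRealSubfield L)) (β : v.adicCompletion ↥(maximalRealSubfield L))
        (algebraMap ↥(maximalRealSubfield L) _ ((cmQuadraticGenerator L : 𝓞 ↥(maximalRealSubfield L)) : ↥(maximalRealSubfield L))) : ℂ) := by
  haveI : Algebra.IsQuadraticExtension ↥(maximalRealSubfield L) L := IsCMField.isQuadraticExtension L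
  rw [HeckeCharacter.localComponent_apply, ← ideleBaseChange_localUnits_of_smul_eq L v w hw β, hμω, quadraticHeckeCharCM_def,
    quadraticHeckeChar_localUnits (not_isSquare_cmQuadraticGenerator L) v β]

include hw hμω in
/-- **CORE — THE VALUE `μ_w(z − 1)` AT A NON-SPLIT PLACE UNDER THE GUARD, THROUGH THE CAYLEY PARAMETER.**  `η` skew non-zero, `M₀ ≥ 1` a level with `μ_w ≡ 1` on
`{s : |s − 1|_w ≤ |ϖ^{M₀}|_w}` (★ p08 `exists_forall_localComponent_eq_one_of_valued_sub_one_le`), `z ∈ K¹` with `z ≠ 1` DEEP: `|z − 1|_w ≤ |2·ϖ^{M₀}|_w`, and `b₀ ∈ L⁺_vˣ` its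
Cayley parameter (`ι_w b₀ = (z − 1)∕((z + 1)η)`).  Then `μ_w(z − 1) = μ_w(2η) · (b₀, θ)_v` (`z − 1 = (2η)·ι_w b₀·(z+1)∕2` and `μ_w((z+1)∕2) = 1`).  (The identity needs
neither `ση = −η` nor `σz·z = 1` — those only make `b₀ ∈ L⁺_v` EXIST, `exists_units_toPlace_eq_cayley_div`.)  RAMIFIED twin of p08's
`localComponent_sub_one_eq_neg_one_pow_mul` (there `(b₀, θ)_v·μ_w(2η)` collapses to `(−1)^N μ_w(δ)` because units are norms); valid at every non-split place.
[cite: Rogawski1990, §4.9 Lemma 4.9.3 (4.9.2) p. 56; §4.9 p. 55] [cite: LabesseLanglands1979, §2 (2.1)–(2.2)] [cite: TateThesis1967, §2.3] -/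
theorem localComponent_sub_one_eq_mul_hilbertSymbol {η : w.1.adicCompletion L} (hη0 : η ≠ 0) (h2η : 2 * η ≠ 0)
    {M₀ : ℕ} (hM₁ : 1 ≤ M₀) (hM₀ : ∀ (s : w.1.adicCompletion L) (hs : s ≠ 0),
      Valued.v (s - 1) ≤ Valued.v ((toPlace v w (HeckeCharacter.uniformizer ↥(maximalRealSubfield L) v : v.adicCompletion ↥(maximalRealSubfield L))) ^ M₀) →
      μ.localComponent w.1 (Units.mk0 s hs) = 1)
    {z : w.1.adicCompletion L} (hz1 : z - 1 ≠ 0)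
    (hdeep : Valued.v (z - 1) ≤ Valued.v (2 * (toPlace v w (HeckeCharacter.uniformizer ↥(maximalRealSubfield L) v : v.adicCompletion ↥(maximalRealSubfield L))) ^ M₀))
    (b₀ : (v.adicCompletion ↥(maximalRealSubfield L))ˣ)
    (hb : toPlace v w (b₀ : v.adicCompletion ↥(maximalRealSubfield L)) = (z - 1) / ((z + 1) * η)) :
    ((μ.localComponent w.1 (Units.mk0 (z - 1) hz1) : ℂˣ) : ℂ) =
      ((μ.localComponent w.1 (Units.mk0 (2 * η) h2η) : ℂˣ) : ℂ) *
        (hilbertSymbol (v.adicCompletion ↥(maximalRealSubfield L)) (b₀ : v.adicCompletion ↥(maximalRealSubfield L))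
          (algebraMap ↥(maximalRealSubfield L) _ ((cmQuadraticGenerator L : 𝓞 ↥(maximalRealSubfield L)) : ↥(maximalRealSubfield L))) : ℂ) := by
  classical
  set ϖ : w.1.adicCompletion L := toPlace v w (HeckeCharacter.uniformizer ↥(maximalRealSubfield L) v : v.adicCompletion ↥(maximalRealSubfield L)) with hϖdef
  have hϖ1 : Valued.v ϖ < 1 := by
    haveI := PlacesOver.liesOver w
    rw [hϖdef, valued_toPlace, HeckeCharacter.valued_uniformizer]
    exact pow_lt_one₀ zero_le (by rw [← WithZero.exp_zero]; exact WithZero.exp_lt_exp.2 (by norm_num))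
      (Ideal.IsDedekindDomain.ramificationIdx'_ne_zero_of_liesOver w.1.asIdeal v.ne_bot)
  have hϖM1 : Valued.v (ϖ ^ M₀) < 1 := by rw [Valuation.map_pow]; exact pow_lt_one₀ zero_le hϖ1 (by omega)
  have h2 : (2 : w.1.adicCompletion L) ≠ 0 := fun h0 => h2η (by rw [h0, zero_mul])
  have hv2 : Valued.v (2 : w.1.adicCompletion L) ≠ 0 := (Valuation.ne_zero_iff _).2 h2
  -- `z + 1 ≠ 0`: otherwise `z − 1 = −2` is not deep
  have hz1p : z + 1 ≠ 0 := by
    intro h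
    have hz' : z - 1 = -2 := by linear_combination h
    have hlt : Valued.v (2 * ϖ ^ M₀) < Valued.v (z - 1) := by
      rw [hz', Valuation.map_neg, Valuation.map_mul]
      calc Valued.v (2 : w.1.adicCompletion L) * Valued.v (ϖ ^ M₀) < Valued.v (2 : w.1.adicCompletion L) * 1 :=
            mul_lt_mul_of_pos_left hϖM1 (zero_lt_iff.2 hv2)
        _ = Valued.v (2 : w.1.adicCompletion L) := mul_one _
    exact absurd hdeep (not_le.2 hlt)
  -- the `(z + 1)∕2` factor is `μ_w`-trivial
  set t : w.1.adicCompletion L := (z + 1) / 2 with htdef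
  have ht1 : t - 1 = (z - 1) / 2 := by rw [htdef]; field_simp; ring
  have htv : Valued.v (t - 1) ≤ Valued.v (ϖ ^ M₀) := by
    rw [ht1, Valuation.map_div, div_le_iff₀ (zero_lt_iff.2 hv2), mul_comm]
    rw [Valuation.map_mul] at hdeep
    exact hdeep
  have ht0 : t ≠ 0 := by rw [htdef]; exact div_ne_zero hz1p h2
  have hμt : μ.localComponent w.1 (Units.mk0 t ht0) = 1 := hM₀ t ht0 htv
  -- `ι_w b₀ ≠ 0` and the factorisation of `z − 1`
  have hb0 : toPlace v w (b₀ : v.adicCompletion ↥(maximalRealSubfield L)) ≠ 0 := by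
    rw [hb]; exact div_ne_zero hz1 (mul_ne_zero hz1p hη0)
  have hfac : z - 1 = (2 * η) * toPlace v w (b₀ : v.adicCompletion ↥(maximalRealSubfield L)) * t :=
    sub_one_eq_mul_toPlace_mul L v w hη0 hz1p h2 hb
  have hunits : Units.mk0 (z - 1) hz1 =
      Units.mk0 (2 * η) h2η * Units.map (toPlace v w : v.adicCompletion ↥(maximalRealSubfield L) →* w.1.adicCompletion L) b₀ * Units.mk0 t ht0 :=
    Units.ext (by rw [Units.val_mul, Units.val_mul, Units.val_mk0, Units.val_mk0, Units.val_mk0, Units.coe_map, MonoidHom.coe_coe, hfac])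
  rw [hunits, map_mul, map_mul, hμt, mul_one, Units.val_mul, localComponent_map_toPlace_eq_hilbertSymbol L v w hw μ hμω b₀]

end Guard

/-! ## §3 The letter's tokens: `D_H` at a ramified place, and the HEAD -/

section Letter

include hw in
/-- **`N𝔓_w = N𝔭_v` AT A RAMIFIED NON-SPLIT PLACE** (`f(w|v) = 1`, ★ `inertiaDeg_eq_one_of_ne_one`; Mathlib `Ideal.absNorm_pow_inertiaDeg`).
[cite: NeukirchANT1999, Ch. I §8 Prop. 8.2] -/
theorem absNorm_placesOver_eq_of_ramified (he : v.asIdeal.ramificationIdx' w.1.asIdeal ≠ 1) :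
    Ideal.absNorm w.1.asIdeal = Ideal.absNorm v.asIdeal := by
  haveI : Algebra.IsQuadraticExtension ↥(maximalRealSubfield L) L := IsCMField.isQuadraticExtension L
  haveI := PlacesOver.liesOver (E := L) w
  have h := Ideal.absNorm_pow_inertiaDeg v.asIdeal w.1.asIdeal
  rw [Liu2021.LemD1IndexedNonVacuityRamifiedPlace.inertiaDeg_eq_one_of_ne_one L v (IsCMField.complexConj L) (IsCMField.complexConj_ne_one L) w hw he,
    pow_one] at h
  exact h.symm

include hw in
/-- **`(Π_{w'} ‖x_{w'}‖_{w'})^{1∕2} = (√q)^{ord}`** at a RAMIFIED non-split place: the product has the single factor `w`, `‖x‖_w = (N𝔓_w)^{log|x|_w}` (★ `norm_eq_absNorm_zpow_log`)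
and `N𝔓_w = q := #(𝓞_{L⁺}∕v)` — print's `D_H = |γ₁ − γ₃|_w^{1∕2}`. [cite: Rogawski1990, §4.9 p. 55; §4.3 (4.3.1) p. 43] [cite: NeukirchANT1999, Ch. II §6] -/
theorem sqrt_prod_norm_eq_sqrt_zpow_log_of_ramified (he : v.asIdeal.ramificationIdx' w.1.asIdeal ≠ 1) {x : LocalRing L v} (hx : x w ≠ 0) :
    Real.sqrt (∏ w' : PlacesOver L v, ‖x w'‖) =
      Real.sqrt (((Nat.card (𝓞 ↥(maximalRealSubfield L) ⧸ v.asIdeal) : ℝ) ^ WithZero.log (Valued.v (x w)))) := by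
  haveI hv : Subsingleton (PlacesOver L v) :=
    PlacesOver.subsingleton_of_smul_eq (IsCMField.complexConj L) (IsCMField.complexConj_ne_one L) w hw
  have hq : Ideal.absNorm v.asIdeal = Nat.card (𝓞 ↥(maximalRealSubfield L) ⧸ v.asIdeal) := by
    rw [Ideal.absNorm_apply, Submodule.cardQuot_apply]
  rw [Fintype.prod_subsingleton _ w, norm_eq_absNorm_zpow_log L hx, absNorm_placesOver_eq_of_ramified L v w hw he, hq]

include hw in
/-- **`D_H = q^{−r}·(√q)⁻¹` WHEN `ord_w(x) = 2r + 1`** (the odd depths near the singular torus at a ramified place; `q = #k_v`).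
[cite: Rogawski1990, §4.9 p. 55] [cite: LabesseLanglands1979, §2 p. 8 (`δ_m = 2q^m`)] -/
theorem sqrt_prod_norm_eq_of_log_eq_neg_odd (he : v.asIdeal.ramificationIdx' w.1.asIdeal ≠ 1) {x : LocalRing L v} (hx : x w ≠ 0) {r : ℕ}
    (hlog : WithZero.log (Valued.v (x w)) = -((2 * r + 1 : ℕ) : ℤ)) :
    Real.sqrt (∏ w' : PlacesOver L v, ‖x w'‖) =
      ((Nat.card (𝓞 ↥(maximalRealSubfield L) ⧸ v.asIdeal) : ℝ) ^ r)⁻¹ * (Real.sqrt ((Nat.card (𝓞 ↥(maximalRealSubfield L) ⧸ v.asIdeal) : ℝ)))⁻¹ := by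
  rw [sqrt_prod_norm_eq_sqrt_zpow_log_of_ramified L v w hw he hx, hlog, zpow_neg, zpow_natCast, Real.sqrt_inv, pow_succ, pow_mul',
    Real.sqrt_mul (by positivity), Real.sqrt_sq (by positivity), mul_inv]

variable (μ : HeckeCharacter L)
  (hμω : ∀ x : ideleGroup ↥(maximalRealSubfield L), μ (AdeleRing.ideleBaseChange ↥(maximalRealSubfield L) L x) = quadraticHeckeCharCM L x)

include hw hμω in
/-- **HEAD — THE `μ`-PART OF THE RANK-ONE TRANSFER FACTOR NEAR THE SINGULAR SUB-TORUS AT A (RAMIFIED) NON-SPLIT PLACE.**  Under print's guard there are a level `M₀`, a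
skew `η ≠ 0` and a constant `C ≠ 0` (`C = μ_w(2η)`) such that for all `a, c ∈ E_v` with `c` norm-one (`σc·c = 1`; in use `a = γ₁(t)`, `c = γ₃(t)`, the eigenvalues of the
`U(Φ₂)`-part of `t ∈ C` — `a` norm-one too, which is what makes `b₀` below EXIST, `exists_units_toPlace_eq_cayley_div`) which are DEEP (`|a_w − c_w|_w ≤ |2ϖ_v^{M₀}|_w`) and
every `b₀ ∈ L⁺_vˣ` with `ι_w b₀ = (a_w∕c_w − 1)∕((a_w∕c_w + 1)η)` (the Cayley parameter of `γ₁∕γ₃`):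
`μ_v(a − c)⁻¹ = μ_v(c)⁻¹ · C⁻¹ · (b₀, θ)_v` — the factor `μ⁻¹(γ₁ − γ₃)` of (4.9.2) read through ★ `finHeckeValue`; multiply by `sqrt_prod_norm_eq_of_log_eq_neg_odd` for
`Δ_{H∕C}(t)`.  RAMIFIED twin of ★ p08 `exists_finHeckeValue_sub_inv_mul_sqrt_eq` (valid at every non-split place; at an unramified one `(b₀,θ)_v·C⁻¹` is p08's
`(−1)^N μ_w(δ)⁻¹`). [cite: Rogawski1990, §4.9 Lemma 4.9.3 (4.9.2) p. 56; §4.9 p. 55] [cite: LabesseLanglands1979, §2 (2.1)–(2.2)] -/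
theorem exists_finHeckeValue_sub_inv_eq_mul_hilbertSymbol :
    ∃ (M₀ : ℕ) (η : w.1.adicCompletion L) (C : ℂ), galAdicCompletionMap (L := L) (IsCMField.complexConj L) hw η = -η ∧ η ≠ 0 ∧ C ≠ 0 ∧
      ∀ (a c : LocalRing L v) (b₀ : (v.adicCompletion ↥(maximalRealSubfield L))ˣ), conjLocal L (IsCMField.complexConj L) v c * c = 1 →
      Valued.v (a w - c w) ≤ Valued.v (2 * (toPlace v w (HeckeCharacter.uniformizer ↥(maximalRealSubfield L) v : v.adicCompletion ↥(maximalRealSubfield L))) ^ M₀) →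
      toPlace v w (b₀ : v.adicCompletion ↥(maximalRealSubfield L)) = (a w / c w - 1) / ((a w / c w + 1) * η) →
      (finHeckeValue L v μ (a - c))⁻¹ =
        (finHeckeValue L v μ c)⁻¹ * C⁻¹ *
          (hilbertSymbol (v.adicCompletion ↥(maximalRealSubfield L)) (b₀ : v.adicCompletion ↥(maximalRealSubfield L))
            (algebraMap ↥(maximalRealSubfield L) _ ((cmQuadraticGenerator L : 𝓞 ↥(maximalRealSubfield L)) : ↥(maximalRealSubfield L))) : ℂ) := by
  classical
  haveI : Algebra.IsQuadraticExtension ↥(maximalRealSubfield L) L := IsCMField.isQuadraticExtension L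
  have hc1 : IsCMField.complexConj L ≠ 1 := IsCMField.complexConj_ne_one L
  haveI hv : Subsingleton (PlacesOver L v) := PlacesOver.subsingleton_of_smul_eq (IsCMField.complexConj L) hc1 w hw
  have hinj : Function.Injective (algebraMap L (w.1.adicCompletion L)) := (algebraMap L (w.1.adicCompletion L)).injective
  haveI : CharZero (w.1.adicCompletion L) := charZero_of_injective_algebraMap hinj
  obtain ⟨M₀, hM₁, hM₀⟩ := exists_forall_localComponent_eq_one_of_valued_sub_one_le L v w μ
  obtain ⟨η, hση, hη0⟩ := exists_skew_ne_zero L v w hw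
  have h2η : (2 : w.1.adicCompletion L) * η ≠ 0 := mul_ne_zero two_ne_zero hη0
  refine ⟨M₀, η, ((μ.localComponent w.1 (Units.mk0 (2 * η) h2η) : ℂˣ) : ℂ), hση, hη0, Units.ne_zero _, fun a c b₀ hc hdeep hb => ?_⟩
  have hvc : Valued.v (c w) = 1 := valued_apply_eq_one_of_conjLocal_mul_self L v w hw hc
  have hc0 : c w ≠ 0 := fun h0 => by rw [h0, map_zero] at hvc; exact zero_ne_one hvc
  -- `z := a_w / c_w`, with `z - 1 = (a_w - c_w) / c_w`
  set z : w.1.adicCompletion L := a w / c w with hzdef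
  have hzsub : z - 1 = (a w - c w) / c w := by rw [hzdef]; field_simp
  -- `b₀` a unit forces `z ≠ 1`
  have hb0 : toPlace v w (b₀ : v.adicCompletion ↥(maximalRealSubfield L)) ≠ 0 := by
    rw [Ne, map_eq_zero_iff _ (toPlace v w).injective]
    exact b₀.ne_zero
  have hz1 : z - 1 ≠ 0 := by
    intro h0
    apply hb0
    rw [hb, h0, zero_div]
  have hac0 : a w - c w ≠ 0 := by
    intro h0
    apply hz1
    rw [hzsub, h0, zero_div]
  have hdeep' : Valued.v (z - 1) ≤
      Valued.v (2 * (toPlace v w (HeckeCharacter.uniformizer ↥(maximalRealSubfield L) v : v.adicCompletion ↥(maximalRealSubfield L))) ^ M₀) := by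
    rw [hzsub, Valuation.map_div, hvc, div_one]; exact hdeep
  have hcore := localComponent_sub_one_eq_mul_hilbertSymbol L v w hw μ hμω hη0 h2η hM₁ hM₀ hz1 hdeep' b₀ hb
  have hcne : c ≠ 0 := fun h0 => hc0 (by rw [h0, Pi.zero_apply])
  have hacne : a - c ≠ 0 := fun h0 => hac0 (by rw [← Pi.sub_apply, h0, Pi.zero_apply])
  have hcu : IsUnit c := isUnit_localRing_of_ne_zero_of_subsingleton L v hv hcne
  have hacu : IsUnit (a - c) := isUnit_localRing_of_ne_zero_of_subsingleton L v hv hacne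
  have hu1 : MulEquiv.piUnits hacu.unit w = Units.mk0 (c w) hc0 * Units.mk0 (z - 1) hz1 :=
    Units.ext (by
      rw [Units.val_mul, Units.val_mk0, Units.val_mk0, hzsub, mul_div_cancel₀ _ hc0]
      rfl)
  have hu2 : MulEquiv.piUnits hcu.unit w = Units.mk0 (c w) hc0 := Units.ext rfl
  have hsinv : ((hilbertSymbol (v.adicCompletion ↥(maximalRealSubfield L)) (b₀ : v.adicCompletion ↥(maximalRealSubfield L))
      (algebraMap ↥(maximalRealSubfield L) _ ((cmQuadraticGenerator L : 𝓞 ↥(maximalRealSubfield L)) : ↥(maximalRealSubfield L))) : ℂ))⁻¹ =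
      (hilbertSymbol (v.adicCompletion ↥(maximalRealSubfield L)) (b₀ : v.adicCompletion ↥(maximalRealSubfield L))
        (algebraMap ↥(maximalRealSubfield L) _ ((cmQuadraticGenerator L : 𝓞 ↥(maximalRealSubfield L)) : ↥(maximalRealSubfield L))) : ℂ) :=
    inv_eq_of_mul_eq_one_left (hilbertSymbol_cast_mul_self _ _)
  rw [finHeckeValue_eq_localComponent_of_nonsplit L v w hw μ hacu, finHeckeValue_eq_localComponent_of_nonsplit L v w hw μ hcu, hu1, hu2, map_mul,
    Units.val_mul, hcore, mul_inv, mul_inv, hsinv, mul_assoc]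

end Letter

end Literature.NumberTheory.Rogawski1990

end
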